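import Mathlib
import Summits.MatrixMultiplication.MatrixMultiplication.Theses.MatrixPointInterpolation

/-!
# `TightWindows` (stmt-MatrixMultiplication-18939), negative lane: the shift / corner pair of
# `M_{m+1}(ℂ)` MASQUERADES as `M_5` to degree `2(2m+1)`

Support file of the refutation `MatrixPointInterpolationTightWindowsRefutation.lean` (crux
disprover).  `A = (N, E)`, `N = Σ E_{i,i+1}` the shift (any `N` with `N i j = [j = i+1]`),
`E = E_{m,0}` the opposite corner unit — the pair of the landed `TightWindowsNeg.shiftPair_gen`.

* *Diagonal support*: `N` lives on the diagonal `i - j = -1`, `E` on `i - j = m`; a word with `c₁`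
  letters `E` and length `ℓ` lives on the diagonal `(m+1)c₁ - ℓ`, empty once `c₁ ≥ 5`,
  `ℓ ≤ 4m + 2`: such words VANISH at `A` (`word_eq_zero_of_five_le_count`).
* *Diagonal test in `M_5(ℂ)`*: at `x = diag(t₀,…,t₄)`, `y = U = Σ E_{i,i+1}`, the entry `(0, j)`
  of a word with `j ≤ 4` letters `y` is the monomial `t₀^{a₀} ⋯ t_j^{a_j}` of its `x`-blocks
  (`test_prod_apply`; the exponent vector is any `e` with the three recursion rules, e.g. the
  `List.foldr` used by the consumers — no definition is introduced), distinct words with the same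
  `j` give distinct monomials (`eq_of_expo_eq`), and a polynomial vanishing on `ℂ^ℕ` is zero
  (`MvPolynomial.funext`): in a two-letter identity of `M_5(ℂ)` every word with `≤ 4` letters `y`
  has coefficient `0` (`coeff_eq_zero_of_identity`) — identities of `M_k` need `k` letters of each
  kind.
Hence every identity of `M_5` of degree `≤ 2(2m+1)` vanishes at `A` (`shiftPair_masq`): with
`shiftPair_gen` this is a masquerade at EVERY size (`LongMasquerade` holds with `k = 5`,
`WindowedKaplansky` fails, and — with the looseness count of the refutation file — `TightWindows`
fails).
-/

set_option linter.dupNamespace false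
-- `MatrixMultiplication.MatrixMultiplication` is the summit/sub-problem path (D-0017)

namespace Summit.MatrixMultiplication.MatrixMultiplication.Theorems

namespace TightWindowsNeg

open scoped BigOperators

/-! ### Diagonal support in `M_n(ℂ)` (`M` lives on the diagonal `s` when `M i j ≠ 0 → i - j = s`) -/

/-- The identity lives on the main diagonal. [folklore] -/
theorem diagSupp_one (n : ℕ) :
    ∀ i j : Fin n, (1 : Matrix (Fin n) (Fin n) ℂ) i j ≠ 0 → (i : ℤ) - (j : ℤ) = 0 := by
  intro i j h
  by_cases hij : i = j
  · subst hij; simp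
  exact absurd (Matrix.one_apply_ne hij) h

/-- Diagonal supports add under multiplication. [folklore] -/
theorem diagSupp_mul {n : ℕ} {s t : ℤ} {M M' : Matrix (Fin n) (Fin n) ℂ}
    (hM : ∀ i j : Fin n, M i j ≠ 0 → (i : ℤ) - (j : ℤ) = s)
    (hM' : ∀ i j : Fin n, M' i j ≠ 0 → (i : ℤ) - (j : ℤ) = t) :
    ∀ i j : Fin n, (M * M') i j ≠ 0 → (i : ℤ) - (j : ℤ) = s + t := by
  intro i j h
  rw [Matrix.mul_apply] at h
  obtain ⟨r, -, hr⟩ := Finset.exists_ne_zero_of_sum_ne_zero h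
  have := hM i r (left_ne_zero_of_mul hr); have := hM' r j (right_ne_zero_of_mul hr); omega

/-- A matrix supported on an empty diagonal is zero. [folklore] -/
theorem eq_zero_of_diagSupp {n : ℕ} {s : ℤ} {M : Matrix (Fin n) (Fin n) ℂ}
    (hM : ∀ i j : Fin n, M i j ≠ 0 → (i : ℤ) - (j : ℤ) = s) (hs : (n : ℤ) ≤ s) : M = 0 := by
  ext i j
  by_contra h
  have := hM i j h; have := i.isLt; have := j.isLt; omega

/-- The diagonal of a word is the sum of the diagonals of its letters. [folklore] -/
theorem diagSupp_prod {n : ℕ} (A : Fin 2 → Matrix (Fin n) (Fin n) ℂ) (s : Fin 2 → ℤ)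
    (hA : ∀ x, ∀ i j : Fin n, A x i j ≠ 0 → (i : ℤ) - (j : ℤ) = s x) (w : List (Fin 2)) :
    ∀ i j : Fin n, ((w.map A).prod) i j ≠ 0 → (i : ℤ) - (j : ℤ) = (w.map s).sum := by
  induction w with
  | nil => simpa using diagSupp_one n
  | cons x w ih => simpa using diagSupp_mul (hA x) ih

/-- Sum of a two-valued letter weight over a word, by letter counts. [folklore] -/
theorem sum_map_fin_two (s : Fin 2 → ℤ) (w : List (Fin 2)) :
    (w.map s).sum = (w.count 0 : ℤ) * s 0 + (w.count 1 : ℤ) * s 1 := by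
  induction w with
  | nil => simp
  | cons x w ih =>
    rw [List.map_cons, List.sum_cons, ih, List.count_cons, List.count_cons]
    obtain rfl | rfl : x = 0 ∨ x = 1 := by fin_cases x <;> simp
    · simp; ring
    · simp; ring

/-- The length of a two-letter word is the sum of its two letter counts. [folklore] -/
theorem length_eq_count_add_count (w : List (Fin 2)) : w.length = w.count 0 + w.count 1 := by
  induction w with
  | nil => simp
  | cons x w ih =>
    rw [List.length_cons, List.count_cons, List.count_cons, ih]
    obtain rfl | rfl : x = 0 ∨ x = 1 := by fin_cases x <;> simp
    · simp; omega
    · simp; omega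

/-! ### The shift / corner pair `(N, E_{m,0})` of `M_{m+1}(ℂ)` -/

/-- The shift lives on the diagonal `-1`. [folklore] -/
theorem diagSupp_shift {m : ℕ} (N : Matrix (Fin (m + 1)) (Fin (m + 1)) ℂ)
    (hN : ∀ i j : Fin (m + 1), N i j = if (j : ℕ) = (i : ℕ) + 1 then 1 else 0) :
    ∀ i j : Fin (m + 1), N i j ≠ 0 → (i : ℤ) - (j : ℤ) = -1 := by
  intro i j h
  rw [hN] at h
  have hij : (j : ℕ) = (i : ℕ) + 1 := by
    by_contra hne
    exact h (if_neg hne)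
  omega

/-- The corner lives on the diagonal `m`. [folklore] -/
theorem diagSupp_corner (m : ℕ) :
    ∀ i j : Fin (m + 1), Matrix.single (Fin.last m) (0 : Fin (m + 1)) (1 : ℂ) i j ≠ 0 →
      (i : ℤ) - (j : ℤ) = m := by
  intro i j h
  rw [Matrix.single_apply] at h
  have hij : Fin.last m = i ∧ (0 : Fin (m + 1)) = j := by
    by_contra hne
    exact h (if_neg hne)
  obtain ⟨rfl, rfl⟩ := hij
  simp

/-- The letters live on the diagonals `-1` (shift) and `m` (corner). [folklore] -/
theorem diagSupp_shiftPair {m : ℕ} (N : Matrix (Fin (m + 1)) (Fin (m + 1)) ℂ)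
    (hN : ∀ i j : Fin (m + 1), N i j = if (j : ℕ) = (i : ℕ) + 1 then 1 else 0) :
    ∀ x : Fin 2, ∀ i j : Fin (m + 1),
      (![N, Matrix.single (Fin.last m) 0 1] : Fin 2 → Matrix (Fin (m + 1)) (Fin (m + 1)) ℂ) x i j ≠ 0 →
      (i : ℤ) - (j : ℤ) = (![-1, (m : ℤ)] : Fin 2 → ℤ) x := by
  intro x
  obtain rfl | rfl : x = 0 ∨ x = 1 := by fin_cases x <;> simp
  · exact diagSupp_shift N hN
  · exact diagSupp_corner m

/-- **Words of the window with at least five corner letters vanish at the shift / corner pair.**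
A word with `c₁` corner letters and length `ℓ` is supported on the diagonal `(m+1) c₁ - ℓ`,
which is empty for `c₁ ≥ 5`, `ℓ ≤ 4m + 2`. [folklore] -/
theorem word_eq_zero_of_five_le_count {m : ℕ} (N : Matrix (Fin (m + 1)) (Fin (m + 1)) ℂ)
    (hN : ∀ i j : Fin (m + 1), N i j = if (j : ℕ) = (i : ℕ) + 1 then 1 else 0)
    (w : List (Fin 2)) (h5 : 5 ≤ w.count 1) (hlen : w.length ≤ 2 * (2 * m + 1)) :
    (w.map (![N, Matrix.single (Fin.last m) 0 1] :
      Fin 2 → Matrix (Fin (m + 1)) (Fin (m + 1)) ℂ)).prod = 0 := by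
  have hsupp := diagSupp_prod _ ![-1, (m : ℤ)] (diagSupp_shiftPair N hN) w
  refine eq_zero_of_diagSupp hsupp ?_
  rw [sum_map_fin_two]
  rw [length_eq_count_add_count] at hlen
  simp only [Matrix.cons_val_zero, Matrix.cons_val_one]
  have h1 : (w.count 0 : ℤ) + (w.count 1 : ℤ) ≤ 2 * (2 * m + 1) := by exact_mod_cast hlen
  have h2 : (5 : ℤ) ≤ w.count 1 := by exact_mod_cast h5
  have h3 : (0 : ℤ) ≤ m := Int.natCast_nonneg m
  push_cast; nlinarith

/-! ### The diagonal test in `M_5(ℂ)`: few corner letters carry no identity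

The exponent vector of a word is abstracted as any `e : List (Fin 2) → ℕ →₀ ℕ` with `e [] = 0`,
`e (0 :: w) = single 0 1 + e w`, `e (1 :: w) = mapDomain succ (e w)` (block lengths, blocks
numbered by the letters `y` to their left); consumers instantiate it with a `List.foldr`. -/

/-- Letter count, leading `x`. [folklore] -/
theorem count_cons_zero (w : List (Fin 2)) : (0 :: w : List (Fin 2)).count 1 = w.count 1 := by simp

/-- Letter count, leading `y`. [folklore] -/
theorem count_cons_one (w : List (Fin 2)) : (1 :: w : List (Fin 2)).count 1 = w.count 1 + 1 := by
  simp

/-- First block length after a leading `x`. [folklore] -/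
theorem expo_cons_zero_apply_zero (e : List (Fin 2) → ℕ →₀ ℕ)
    (hez : ∀ w, e (0 :: w) = Finsupp.single 0 1 + e w) (w : List (Fin 2)) :
    e (0 :: w) 0 = e w 0 + 1 := by
  rw [hez, Finsupp.add_apply, Finsupp.single_eq_same, add_comm]

/-- The first block length vanishes after a leading `y`. [folklore] -/
theorem expo_cons_one_apply_zero (e : List (Fin 2) → ℕ →₀ ℕ)
    (heo : ∀ w, e (1 :: w) = Finsupp.mapDomain Nat.succ (e w)) (w : List (Fin 2)) :
    e (1 :: w) 0 = 0 := by
  rw [heo]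
  exact Finsupp.mapDomain_notin_range _ _ (by simp)

/-- Words with the same number of letters `y` and the same exponent vector coincide. [folklore] -/
theorem eq_of_expo_eq (e : List (Fin 2) → ℕ →₀ ℕ) (he0 : e [] = 0)
    (hez : ∀ w, e (0 :: w) = Finsupp.single 0 1 + e w)
    (heo : ∀ w, e (1 :: w) = Finsupp.mapDomain Nat.succ (e w)) :
    ∀ (w w' : List (Fin 2)), w.count 1 = w'.count 1 → e w = e w' → w = w' := by
  intro w
  induction w with
  | nil =>
    intro w' hc he
    cases w' with
    | nil => rfl
    | cons y w' =>
      exfalso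
      obtain rfl | rfl : y = 0 ∨ y = 1 := by fin_cases y <;> simp
      · have h := DFunLike.congr_fun he 0
        rw [he0, Finsupp.zero_apply, expo_cons_zero_apply_zero e hez] at h; omega
      · rw [count_cons_one] at hc; simp at hc
  | cons x w ih =>
    intro w' hc he
    cases w' with
    | nil =>
      exfalso
      obtain rfl | rfl : x = 0 ∨ x = 1 := by fin_cases x <;> simp
      · have h := DFunLike.congr_fun he 0
        rw [he0, Finsupp.zero_apply, expo_cons_zero_apply_zero e hez] at h; omega
      · rw [count_cons_one] at hc; simp at hc
    | cons y w' =>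
      obtain rfl | rfl : x = 0 ∨ x = 1 := by fin_cases x <;> simp
      · obtain rfl | rfl : y = 0 ∨ y = 1 := by fin_cases y <;> simp
        · rw [count_cons_zero, count_cons_zero] at hc
          rw [hez, hez] at he
          rw [ih w' hc (add_left_cancel he)]
        · exfalso
          have h := DFunLike.congr_fun he 0
          rw [expo_cons_zero_apply_zero e hez, expo_cons_one_apply_zero e heo] at h; omega
      · obtain rfl | rfl : y = 0 ∨ y = 1 := by fin_cases y <;> simp
        · exfalso
          have h := DFunLike.congr_fun he 0
          rw [expo_cons_zero_apply_zero e hez, expo_cons_one_apply_zero e heo] at h; omega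
        · rw [count_cons_one, count_cons_one] at hc
          rw [heo, heo] at he
          rw [ih w' (by omega) (Finsupp.mapDomain_injective Nat.succ_injective he)]

/-- **Row formula for the diagonal test.**  The entry `(i, q)` of a word at `(diag t, U)` is the
value of its monomial at the shifted variables `t (i + ·)` if `q = i + #y`, and `0` otherwise.
[folklore] -/
theorem test_prod_apply (U : Matrix (Fin 5) (Fin 5) ℂ)
    (hU : ∀ i j : Fin 5, U i j = if (j : ℕ) = (i : ℕ) + 1 then 1 else 0)
    (e : List (Fin 2) → ℕ →₀ ℕ) (he0 : e [] = 0)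
    (hez : ∀ w, e (0 :: w) = Finsupp.single 0 1 + e w)
    (heo : ∀ w, e (1 :: w) = Finsupp.mapDomain Nat.succ (e w))
    (t : ℕ → ℂ) (w : List (Fin 2)) (i q : Fin 5) :
    ((w.map (![Matrix.diagonal fun l : Fin 5 => t l, U] : Fin 2 → Matrix (Fin 5) (Fin 5) ℂ)).prod)
        i q =
      if (i : ℕ) + w.count 1 = (q : ℕ) then
        MvPolynomial.eval (fun r => t ((i : ℕ) + r)) (MvPolynomial.monomial (e w) 1) else 0 := by
  induction w generalizing i q with
  | nil =>
    rw [List.map_nil, List.prod_nil, List.count_nil, add_zero, he0, ← MvPolynomial.C_apply,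
      MvPolynomial.C_1, map_one, Matrix.one_apply]
    by_cases h : i = q
    · subst h; simp
    · have : (i : ℕ) ≠ (q : ℕ) := fun e => h (Fin.ext e)
      rw [if_neg h, if_neg this]
  | cons x w ih =>
    rw [List.map_cons, List.prod_cons]
    obtain rfl | rfl : x = 0 ∨ x = 1 := by fin_cases x <;> simp
    · -- letter `x`: the diagonal matrix multiplies row `i` by `t i`
      have hm : MvPolynomial.monomial (e (0 :: w)) (1 : ℂ) =
          MvPolynomial.X 0 * MvPolynomial.monomial (e w) 1 := by
        rw [hez, ← pow_one (MvPolynomial.X 0), MvPolynomial.X_pow_eq_monomial,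
          MvPolynomial.monomial_mul, one_mul]
      rw [Matrix.cons_val_zero, Matrix.diagonal_mul, ih i q, count_cons_zero, hm, map_mul,
        MvPolynomial.eval_X]
      simp only [add_zero, mul_ite, mul_zero]
    · -- letter `y`: `U` shifts the rows up by one
      have hm : MvPolynomial.monomial (e (1 :: w)) (1 : ℂ) =
          MvPolynomial.rename Nat.succ (MvPolynomial.monomial (e w) 1) := by
        rw [heo, MvPolynomial.rename_monomial]
      rw [Matrix.cons_val_one, Matrix.cons_val_zero, Matrix.mul_apply, count_cons_one, hm,
        MvPolynomial.eval_rename]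
      by_cases hi : (i : ℕ) + 1 < 5
      · rw [Finset.sum_eq_single ⟨(i : ℕ) + 1, hi⟩]
        · rw [hU, if_pos rfl, one_mul, ih]
          have e1 : ((⟨(i : ℕ) + 1, hi⟩ : Fin 5) : ℕ) + w.count 1 = (i : ℕ) + (w.count 1 + 1) := by
            simp only []
            ring
          have e2 : (fun r => t (((⟨(i : ℕ) + 1, hi⟩ : Fin 5) : ℕ) + r)) =
              (fun r => t ((i : ℕ) + r)) ∘ Nat.succ := by
            funext r
            simp only [Function.comp_apply, Nat.succ_eq_add_one]
            congr 1
            omega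
          rw [e1, e2]
        · intro r _ hr
          rw [hU, if_neg, zero_mul]
          intro e
          exact hr (Fin.ext e)
        · intro habs
          exact absurd (Finset.mem_univ _) habs
      · rw [Finset.sum_eq_zero]
        · have hq := q.isLt
          rw [eq_comm, ite_eq_right_iff]
          intro h
          omega
        · intro r _
          have hr := r.isLt
          rw [hU, if_neg (by omega), zero_mul]

/-- **Monomial extraction.**  If a finite combination of DISTINCT monomials vanishes at every
point of `ℂ^ℕ`, all its coefficients vanish. [folklore] -/
theorem eq_zero_of_eval_eq_zero {ι : Type*} (s : Finset ι) (g : ι → ℂ) (e : ι → (ℕ →₀ ℕ))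
    (hinj : Set.InjOn e s)
    (h : ∀ t : ℕ → ℂ, ∑ i ∈ s, g i * MvPolynomial.eval t (MvPolynomial.monomial (e i) 1) = 0) :
    ∀ i ∈ s, g i = 0 := by
  intro i₀ hi₀
  set P : MvPolynomial ℕ ℂ := ∑ i ∈ s, g i • MvPolynomial.monomial (e i) (1 : ℂ) with hP
  have hP0 : P = 0 := by
    apply MvPolynomial.funext
    intro t
    rw [hP, map_sum, map_zero]
    refine Eq.trans (Finset.sum_congr rfl fun i _ => ?_) (h t)
    rw [MvPolynomial.smul_eval]
  have hcoeff : P.coeff (e i₀) = g i₀ := by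
    rw [hP, MvPolynomial.coeff_sum]
    simp only [MvPolynomial.coeff_smul, MvPolynomial.coeff_monomial, smul_eq_mul]
    rw [Finset.sum_eq_single i₀]
    · simp
    · intro i hi hne
      rw [if_neg, mul_zero]
      intro heq
      exact hne (hinj hi hi₀ heq)
    · intro habs
      exact absurd hi₀ habs
  rw [hP0, MvPolynomial.coeff_zero] at hcoeff
  exact hcoeff.symm

/-- **Few corner letters carry no identity.**  In a two-letter identity of `M_5(ℂ)`, every word
with at most four letters `y` has coefficient `0`. [folklore] -/
theorem coeff_eq_zero_of_identity (e : List (Fin 2) → ℕ →₀ ℕ) (he0 : e [] = 0)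
    (hez : ∀ w, e (0 :: w) = Finsupp.single 0 1 + e w)
    (heo : ∀ w, e (1 :: w) = Finsupp.mapDomain Nat.succ (e w))
    (T : Finset (List (Fin 2))) (c : List (Fin 2) → ℂ)
    (hB : ∀ B : Fin 2 → Matrix (Fin 5) (Fin 5) ℂ, (∑ w ∈ T, c w • (w.map B).prod) = 0)
    {w : List (Fin 2)} (hw : w ∈ T) (h4 : w.count 1 ≤ 4) : c w = 0 := by
  -- the words of `T` with exactly `#y(w)` letters `y`, read at entry `(0, #y(w))` of the test
  have key : ∀ t : ℕ → ℂ, ∑ v ∈ T.filter (fun v => v.count 1 = w.count 1),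
      c v * MvPolynomial.eval t (MvPolynomial.monomial (e v) 1) = 0 := by
    intro t
    have h1 := congr_fun (congr_fun (hB ![Matrix.diagonal fun l : Fin 5 => t l,
      fun i j : Fin 5 => if (j : ℕ) = (i : ℕ) + 1 then (1 : ℂ) else 0]) 0) ⟨w.count 1, by omega⟩
    rw [Matrix.sum_apply, Matrix.zero_apply] at h1
    simp only [Matrix.smul_apply, test_prod_apply (fun i j : Fin 5 => if (j : ℕ) = (i : ℕ) + 1
      then (1 : ℂ) else 0) (fun _ _ => rfl) e he0 hez heo, smul_eq_mul, Fin.val_zero, zero_add,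
      mul_ite, mul_zero] at h1
    rw [Finset.sum_filter]
    refine Eq.trans (Finset.sum_congr rfl fun v _ => ?_) h1
    by_cases hv : v.count 1 = w.count 1
    · simp only [if_pos hv]
    · simp only [if_neg hv]
  have hinj : Set.InjOn e (T.filter (fun v => v.count 1 = w.count 1) : Finset (List (Fin 2))) := by
    intro v hv v' hv' he
    have hv2 := (Finset.mem_filter.1 (Finset.mem_coe.1 hv)).2
    have hv'2 := (Finset.mem_filter.1 (Finset.mem_coe.1 hv')).2
    exact eq_of_expo_eq e he0 hez heo v v' (hv2.trans hv'2.symm) he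
  exact eq_zero_of_eval_eq_zero _ c e hinj key w (Finset.mem_filter.2 ⟨hw, rfl⟩)

/-- **The shift / corner pair masquerades as `M_5` to degree `2d = 4m + 2`**: every two-letter
identity of `M_5(ℂ)` of degree `≤ 4m + 2` vanishes at `(N, E_{m,0})`. [folklore] -/
theorem shiftPair_masq {m : ℕ} (N : Matrix (Fin (m + 1)) (Fin (m + 1)) ℂ)
    (hN : ∀ i j : Fin (m + 1), N i j = if (j : ℕ) = (i : ℕ) + 1 then 1 else 0) :
    ∀ (T : Finset (List (Fin 2))) (c : List (Fin 2) → ℂ), (∀ w ∈ T, w.length ≤ 2 * (2 * m + 1)) →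
      (∀ B : Fin 2 → Matrix (Fin 5) (Fin 5) ℂ, (∑ w ∈ T, c w • (w.map B).prod) = 0) →
      (∑ w ∈ T, c w • (w.map (![N, Matrix.single (Fin.last m) 0 1] :
        Fin 2 → Matrix (Fin (m + 1)) (Fin (m + 1)) ℂ)).prod) = 0 := by
  intro T c hT hB
  refine Finset.sum_eq_zero fun w hw => ?_
  by_cases h5 : 5 ≤ w.count 1
  · rw [word_eq_zero_of_five_le_count N hN w h5 (hT w hw), smul_zero]
  · rw [coeff_eq_zero_of_identity
      (List.foldr (fun (x : Fin 2) (f : ℕ →₀ ℕ) =>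
        if x = 0 then Finsupp.single 0 1 + f else Finsupp.mapDomain Nat.succ f) 0)
      rfl (fun v => by simp) (fun v => by simp) T c hB hw (by omega), zero_smul]

end TightWindowsNeg

end Summit.MatrixMultiplication.MatrixMultiplication.Theorems
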